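import Summits.HodgeConjecture.HodgeConjecture.Theorems.Ring2HypothesesDescentMotivatedSemisimple
import Summits.HodgeConjecture.HodgeConjecture.Theorems.Ring2HypothesesDescentMotivatedOperators
import Summits.HodgeConjecture.HodgeConjecture.Theorems.Ring2HypothesesDescentAlgebraicQuasiInverse
import Literature.AlgebraicGeometry.HodgeTheory.MotivatedClassesPointAuxiliary
import HarnessLib

/-!
# Ring 2 hypotheses, descent face — ANDRÉ'S THÉORÈME 0.4 (semisimplicity of motivated motives) REALISED, UNCONDITIONALLY:
# every MOTIVATED correspondence `u : Hᵃ(X(ℂ); ℂ) → Hᵇ(X(ℂ); ℂ)` has a MOTIVATED quasi-inverse `v`, `u v u = u`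

research route conditional on HC_CM; not a corollary; Q11.4-sentence-2 already refuted in dim ≥ 3.
Cell `pub-hodge-ring2` (Hodge ladder STAGE 3), seat `ring2-b05` (binder row b05
`Ring2.Hypotheses.MotivatedImpliesAlgebraicAV`), gen 42. `HC_CM` (`Theses.RankFourFaces.CMAbelianHodge`) does not occur in
this file; nothing here proves a case of the Hodge conjecture or of `B(X)`; NO hypothesis `B` appears: everything below is
an UNCONDITIONAL theorem about André's motivated classes on the real carriers.

André 1996, Thm. 0.4 (p. 7): «la ⊗-catégorie `𝓜` des motifs (définis en termes de cycles motivés) est tannakienne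
semi-simple graduée sur `ℚ`»; in a semisimple abelian category every morphism `u` has a quasi-inverse `v` (`u v u = u`:
split `ker u` and `im u` off). Gens 37/40 realised semisimplicity on the carriers DEGREE BY DEGREE (`R_a(X)` = the
operator algebra of `A_motⁿ(X ⊗ X)_ℂ` on `Hᵃ(X(ℂ); ℂ)` is semisimple, `isSemisimpleRing_adjoin_motivatedOperators`; the lift
of motivated classes through motivated correspondences). This file realises it for MORPHISMS BETWEEN DIFFERENT DEGREES
(`u : Hᵃ(X) → Hᵇ(X)` induced by `A_motᵉ(X ⊗ X)_ℂ`, `a + 2e = b + 2n`), by the corner argument of the companion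
`…AlgebraicQuasiInverse` (gen 42, node (Q) under `B`) run in the MOTIVATED operator algebras, where no `B` is needed:

* §1 **`exists_motivated_quasiInverse_of_injective_of_surjective`** (von Neumann regularity of semisimple rings is the
  companion's `exists_mul_mul_self_eq_of_isSemisimpleRing`) —
  THE CORNER: if `Hᵇ(X) ↪ Hᵏ(Z)` and `Hᵏ(Z) ↠ Hᵃ(X)` through MOTIVATED correspondences `ι`, `p`, then every motivated
  `u : Hᵃ(X) → Hᵇ(X)` has a motivated quasi-inverse `p V ι`, `V` a quasi-inverse of `ι u p` in the semisimple algebra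
  `R_k^{mot}(Z)` (gen 37, unconditional; compositions by gen 36's `comp_mem_map_corrAction_motivatedClasses`).
* §2 `mem_map_corrAction_motivatedClasses_of_isAlgebraicCorrespondence` (algebraic correspondences are motivated ones:
  `A(W ⊗ X) ⊆ A_mot(W ⊗ X)`, a polarisation class of `W ⊗ X` existing) and **`exists_motivated_quasiInverse`** —
  UNCONDITIONAL: for `X` smooth projective, `a, b ≤ 2 dim X` and `u` induced by a motivated class, a motivated `v` with
  `u v u = u`; auxiliary `Z = X × W`, `W` a complex abelian variety of dimension `|e − n|`, embeddings `pr_X^*` / `i_*` and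
  projections `i^*` / `pr_{X*}` (`i = (𝟙, 0_W)`), exactly as in the companion. **`exists_motivated_quasiInverse_of_isAlgebraicCorrespondence`**:
  in particular every ALGEBRAIC correspondence has a MOTIVATED quasi-inverse (no `B`).
* §3 **`exists_algebraic_quasiInverse_of_motivatedClasses_sq_le`** — node (Q)'s conclusion at `X` from «motivated ⟹
  algebraic» on the square `X ⊗ X` in ONE codimension (the quasi-inverse's), with NO `B(X)`: the b05-axis form of the
  supply node (row b05's parent `MotivatedImpliesAlgebraic` restricted to one square, one codimension).

Consumers: the companion `…MotivatedQuasiInversePencils` (gen 42) — motivated quasi-inverses of `L_t = j_{t*} j_t^*` on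
every compact abelian pencil, the β-rungs from «A_mot = A on the squares of the pencil total spaces», and the cell row
with X re-typed on the b05 axis. No definition, no named fact, no sorry. References: Andre1996Motifs (Thm. 0.4 p. 7, §2.1 Corollaire p. 15, Prop. 3.3 pp. 21–22, §4),
Jannsen1992 (Thm. 1, Lemma 1–2), Kleiman1968AlgebraicCycles (§3 Thm. 3.11), Fulton1998 (§16.1 Prop. 16.1.1).
-/

noncomputable section

-- every declaration of this problem lives in `Summit.HodgeConjecture.HodgeConjecture.…` (summit = sub-problem)
set_option linter.dupNamespace false

open CategoryTheory AlgebraicGeometry MonoidalCategory CartesianMonoidalCategory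
open Literature.AlgebraicGeometry Literature.AlgebraicGeometry.Motives
  Literature.AlgebraicGeometry.HodgeTheory
open Summit.HodgeConjecture.HodgeConjecture.Ring2.AbelianAll

namespace Summit.HodgeConjecture.HodgeConjecture.Theorems

/-! ## §1 The corner argument in the motivated operator algebras -/

section Corner

variable {n N : ℕ} {X Z : SchemeOver ℂ}

/-- **THE MOTIVATED CORNER (André Thm. 0.4 between two degrees, through one semisimple algebra).** `X`, `Z` smooth
projective of dimensions `n`, `N`; `ι : Hᵇ(X) → Hᵏ(Z)` injective and `p : Hᵏ(Z) → Hᵃ(X)` surjective, both induced by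
MOTIVATED classes (on `Z ⊗ X`, resp. `X ⊗ Z`); `u : Hᵃ(X) → Hᵇ(X)` induced by a motivated class on `X ⊗ X`. Then there
is `v : Hᵇ(X) → Hᵃ(X)` induced by a motivated class on `X ⊗ X` with `u v u = u`: `U := ι u p` lies in the operator
algebra of `A_mot^N(Z ⊗ Z)_ℂ` on `Hᵏ(Z)`, semisimple UNCONDITIONALLY (gen 37, André Prop. 3.3 / Jannsen); a quasi-inverse
`V` of `U` there is motivated; `v := p V ι` (compositions of motivated correspondences are motivated, §2.1 Corollaire);
with linear retractions `p' ι = 1`, `p ι' = 1`: `u v u = p'(U V U) ι' = p' U ι' = u`.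
[cite: Andre1996Motifs, Thm. 0.4 (p. 7), §2.1 Corollaire (p. 15) and Prop. 3.3 (pp. 21–22)] [cite: Jannsen1992, Thm. 1] -/
theorem exists_motivated_quasiInverse_of_injective_of_surjective (hX : IsSmoothProjective n X)
    (hZ : IsSmoothProjective N Z) {a b k eι ep eu : ℕ} (hb : b ≤ 2 * n) (hk : k ≤ 2 * N)
    (hιd : b + 2 * eι = k + 2 * n) (hpd : k + 2 * ep = a + 2 * N) (hud : a + 2 * eu = b + 2 * n)
    {ι : complexBetti X b →ₗ[ℂ] complexBetti Z k} {p : complexBetti Z k →ₗ[ℂ] complexBetti X a}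
    (hι : ι ∈ (motivatedClasses (N + n) (Z ⊗ X) eι).map (corrAction complexOrientationFamily hZ hX hιd))
    (hp : p ∈ (motivatedClasses (n + N) (X ⊗ Z) ep).map (corrAction complexOrientationFamily hX hZ hpd))
    (hιi : Function.Injective ι) (hps : Function.Surjective p)
    {u : complexBetti X a →ₗ[ℂ] complexBetti X b}
    (hu : u ∈ (motivatedClasses (n + n) (X ⊗ X) eu).map (corrAction complexOrientationFamily hX hX hud)) :
    ∃ (ev : ℕ) (hvd : b + 2 * ev = a + 2 * n) (v : complexBetti X b →ₗ[ℂ] complexBetti X a),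
      v ∈ (motivatedClasses (n + n) (X ⊗ X) ev).map (corrAction complexOrientationFamily hX hX hvd) ∧
        ∀ x : complexBetti X a, u (v (u x)) = u x := by
  -- linear retractions
  obtain ⟨p', hpι⟩ := ι.exists_leftInverse_of_injective (LinearMap.ker_eq_bot.mpr hιi)
  obtain ⟨ι', hpι'⟩ := p.exists_rightInverse_of_surjective (LinearMap.range_eq_top.mpr hps)
  -- `u ∘ p` and `U = ι ∘ u ∘ p` are motivated operators
  obtain ⟨e₁, he₁⟩ : ∃ e₁ : ℕ, eu + ep = e₁ + n := ⟨eu + ep - n, by omega⟩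
  have h₃ : k + 2 * e₁ = b + 2 * N := by omega
  have hup : u ∘ₗ p ∈ (motivatedClasses (n + N) (X ⊗ Z) e₁).map (corrAction complexOrientationFamily hX hZ h₃) :=
    comp_mem_map_corrAction_motivatedClasses complexOrientationFamily hX hX hZ he₁ hpd hud h₃ hu hp
  have heN : eι + e₁ = N + n := by omega
  have hU : ι ∘ₗ (u ∘ₗ p) ∈ (motivatedClasses (N + N) (Z ⊗ Z) N).map
      (corrAction complexOrientationFamily hZ hZ (rfl : k + 2 * N = k + 2 * N)) :=
    comp_mem_map_corrAction_motivatedClasses complexOrientationFamily hZ hX hZ heN h₃ hιd rfl hι hup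
  -- the semisimple motivated operator algebra in degree `k` of `Z`
  set M : Submodule ℂ (Module.End ℂ (complexBetti Z k)) := (motivatedClasses (N + N) (Z ⊗ Z) N).map
    (corrAction complexOrientationFamily hZ hZ (rfl : k + 2 * N = k + 2 * N)) with hMdef
  set R : Subalgebra ℂ (Module.End ℂ (complexBetti Z k)) :=
    Algebra.adjoin ℂ (M : Set (Module.End ℂ (complexBetti Z k))) with hRdef
  haveI : IsSemisimpleRing R := isSemisimpleRing_adjoin_motivatedOperators complexOrientationFamily hZ k
  have hRM : ∀ x : Module.End ℂ (complexBetti Z k), x ∈ R ↔ x ∈ M := fun x ↦ by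
    rw [← SetLike.mem_coe, hRdef, hMdef, adjoin_motivatedOperators_eq complexOrientationFamily hZ k, SetLike.mem_coe]
  set U : complexBetti Z k →ₗ[ℂ] complexBetti Z k := ι ∘ₗ (u ∘ₗ p) with hUdef
  obtain ⟨V, hV⟩ := exists_mul_mul_self_eq_of_isSemisimpleRing (R := R) ⟨U, (hRM U).mpr hU⟩
  have hVM : (V : Module.End ℂ (complexBetti Z k)) ∈ M := (hRM _).mp V.2
  have hUVU : ∀ z : complexBetti Z k, U ((V : Module.End ℂ (complexBetti Z k)) (U z)) = U z := fun z ↦ by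
    have h := congrArg (fun T : R ↦ (T : Module.End ℂ (complexBetti Z k)) z) hV
    simpa only [Subalgebra.coe_mul, Module.End.mul_apply] using h
  -- `v := p ∘ V ∘ ι` is motivated
  have hVι : (V : Module.End ℂ (complexBetti Z k)) ∘ₗ ι ∈ (motivatedClasses (N + n) (Z ⊗ X) eι).map
      (corrAction complexOrientationFamily hZ hX hιd) :=
    comp_mem_map_corrAction_motivatedClasses complexOrientationFamily hZ hZ hX (Nat.add_comm N eι) hιd rfl hιd hVM hι
  obtain ⟨ev, hev⟩ : ∃ ev : ℕ, ep + eι = ev + N := ⟨ep + eι - N, by omega⟩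
  have hvd : b + 2 * ev = a + 2 * n := by omega
  refine ⟨ev, hvd, p ∘ₗ ((V : Module.End ℂ (complexBetti Z k)) ∘ₗ ι),
    comp_mem_map_corrAction_motivatedClasses complexOrientationFamily hX hZ hX hev hιd hpd hvd hp hVι, fun x ↦ ?_⟩
  have hpι'x : p (ι' x) = x := by
    simpa only [LinearMap.comp_apply, LinearMap.id_apply] using LinearMap.congr_fun hpι' x
  have hp'ι : ∀ y : complexBetti X b, p' (ι y) = y := fun y ↦ by
    simpa only [LinearMap.comp_apply, LinearMap.id_apply] using LinearMap.congr_fun hpι y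
  have h := hUVU (ι' x)
  simp only [hUdef, LinearMap.comp_apply, hpι'x] at h
  have h' := congrArg p' h
  rwa [hp'ι, hp'ι] at h'

end Corner

/-! ## §2 The unconditional motivated quasi-inverse -/

section Unconditional

variable {m n : ℕ} {W X : SchemeOver ℂ}

/-- **Algebraic correspondences are motivated correspondences (operator form)**: `T` induced by an algebraic class on
`W ⊗ X` is induced, for the complex orientations, by a MOTIVATED class of the same codimension (`A(W ⊗ X) ⊆ A_mot(W ⊗ X)`,
André §2.1 «il est clair», the tree's `algebraicClasses_le_motivatedClasses_of_isPolarizationClass` with a polarisation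
class of `W ⊗ X` from `exists_isPolarizationClass`). [cite: Andre1996Motifs, §2.1 remark following Déf. 1 (p. 14)] -/
theorem mem_map_corrAction_motivatedClasses_of_isAlgebraicCorrespondence (hW : IsSmoothProjective m W)
    (hX : IsSmoothProjective n X) {a b : ℕ} {T : complexBetti X a →ₗ[ℂ] complexBetti W b}
    (hT : IsAlgebraicCorrespondence m n W X T) :
    ∃ (e : ℕ) (hab : a + 2 * e = b + 2 * n),
      T ∈ (motivatedClasses (m + n) (W ⊗ X) e).map (corrAction complexOrientationFamily hW hX hab) := by
  obtain ⟨e, hab, γ, hγ, rfl⟩ := IsAlgebraicCorrespondence.exists_eq_corrAction hW hX hT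
  obtain ⟨θ, hθ⟩ := exists_isPolarizationClass (hW.tensor_holds hX)
  exact ⟨e, hab, γ, algebraicClasses_le_motivatedClasses_of_isPolarizationClass (hW.tensor_holds hX) hθ e hγ, rfl⟩

/-- **ANDRÉ THM. 0.4 REALISED — every MOTIVATED correspondence `u : Hᵃ(X(ℂ); ℂ) → Hᵇ(X(ℂ); ℂ)` (`a, b ≤ 2 dim X`, `u`
induced by `A_motᵉ(X ⊗ X)_ℂ` for the complex orientations) has a MOTIVATED quasi-inverse `v : Hᵇ → Hᵃ`, `u v u = u` —
UNCONDITIONALLY.** Auxiliary `Z := X × W`, `W` a complex abelian variety of dimension `|e − n|` (any elliptic curve if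
`e = n`), `i = (𝟙, 0) : X → Z`; degree `k := a` with `ι := i_*` (resp. `pr_X^*`), `p := i^*` if `e ≤ n`, `k := b` with
`ι := pr_X^*`, `p := pr_{X*}` if `e > n` — algebraic (graphs), hence motivated, injective / surjective by `i ≫ pr_X = 𝟙`;
conclude by the corner §1. [cite: Andre1996Motifs, Thm. 0.4 (p. 7) and Prop. 3.3 (pp. 21–22)] [cite: Jannsen1992, Thm. 1] -/
theorem exists_motivated_quasiInverse (hX : IsSmoothProjective n X) {a b e : ℕ} (ha : a ≤ 2 * n) (hb : b ≤ 2 * n)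
    (hab : a + 2 * e = b + 2 * n) {u : complexBetti X a →ₗ[ℂ] complexBetti X b}
    (hu : u ∈ (motivatedClasses (n + n) (X ⊗ X) e).map (corrAction complexOrientationFamily hX hX hab)) :
    ∃ (e' : ℕ) (hba : b + 2 * e' = a + 2 * n) (v : complexBetti X b →ₗ[ℂ] complexBetti X a),
      v ∈ (motivatedClasses (n + n) (X ⊗ X) e').map (corrAction complexOrientationFamily hX hX hba) ∧
        ∀ x : complexBetti X a, u (v (u x)) = u x := by
  have hPD := hasPoincareDuality_complexOrientationFamily
  rcases Nat.lt_trichotomy e n with hlt | heq | hgt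
  · -- `e < n`: `a = b + 2m`; `ι := i_* : Hᵇ(X) ↪ Hᵃ(Z)`, `p := i^* : Hᵃ(Z) ↠ Hᵃ(X)`
    obtain ⟨W, hWd⟩ := exists_abelianVariety_dim_eq_succ ℂ (n - e - 1)
    have hm : e + W.dim = n := by omega
    have hW : IsSmoothProjective W.dim W.X := AbelianVariety.isSmoothProjective_holds (A := W)
    have hZ : IsSmoothProjective (n + W.dim) (X ⊗ W.X) := hX.tensor_holds hW
    set w₀ : ComplexPoints W.X := (1 : W.Points ℂ)
    have h1 : b + 2 * (n + W.dim) = a + 2 * n := by omega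
    have h2 : a + 2 * n = b + 2 * (n + W.dim) := by omega
    obtain ⟨eι, hιd, hι⟩ := mem_map_corrAction_motivatedClasses_of_isAlgebraicCorrespondence hZ hX
      (isAlgebraicCorrespondence_complexGysin complexOrientationFamily hPD hX hZ (sliceAt X w₀) h1
        (show a + (2 * (n + W.dim) - a) = 2 * (n + W.dim) by omega))
    obtain ⟨ep, hpd, hp⟩ := mem_map_corrAction_motivatedClasses_of_isAlgebraicCorrespondence hX hZ
      (isAlgebraicCorrespondence_map hX hZ (sliceAt X w₀) ha)
    refine exists_motivated_quasiInverse_of_injective_of_surjective hX hZ hb (k := a) (by omega) hιd hpd hab hι hp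
      ?_ ?_ hu
    · exact Function.LeftInverse.injective
        (g := complexGysin complexOrientationFamily hZ hX (fst X W.X) h2) fun x ↦ by
          simpa only [LinearMap.comp_apply, LinearMap.id_apply] using
            LinearMap.congr_fun (complexGysin_fst_comp_complexGysin_sliceAt hX hW w₀ h1 h2) x
    · exact Function.RightInverse.surjective (g := (complexBetti.map (fst X W.X) a).hom) fun x ↦ by
        simpa only [LinearMap.comp_apply, LinearMap.id_apply] using
          LinearMap.congr_fun (map_sliceAt_comp_map_fst (X := X) w₀ a) x
  · -- `e = n`: `a = b`; any elliptic curve `W`, same-degree embedding and projection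
    subst heq
    obtain rfl : a = b := by omega
    obtain ⟨W, -⟩ := exists_abelianVariety_dim_eq_succ ℂ 0
    have hW : IsSmoothProjective W.dim W.X := AbelianVariety.isSmoothProjective_holds (A := W)
    have hZ : IsSmoothProjective (e + W.dim) (X ⊗ W.X) := hX.tensor_holds hW
    set w₀ : ComplexPoints W.X := (1 : W.Points ℂ)
    obtain ⟨eι, hιd, hι⟩ := mem_map_corrAction_motivatedClasses_of_isAlgebraicCorrespondence hZ hX
      (isAlgebraicCorrespondence_map hZ hX (fst X W.X) (a := a) (by omega))
    obtain ⟨ep, hpd, hp⟩ := mem_map_corrAction_motivatedClasses_of_isAlgebraicCorrespondence hX hZ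
      (isAlgebraicCorrespondence_map hX hZ (sliceAt X w₀) ha)
    refine exists_motivated_quasiInverse_of_injective_of_surjective hX hZ hb (k := a) (by omega) hιd hpd hab hι hp
      ?_ ?_ hu
    · exact Function.LeftInverse.injective (g := (complexBetti.map (sliceAt X w₀) a).hom) fun x ↦ by
        simpa only [LinearMap.comp_apply, LinearMap.id_apply] using
          LinearMap.congr_fun (map_sliceAt_comp_map_fst (X := X) w₀ a) x
    · exact Function.RightInverse.surjective (g := (complexBetti.map (fst X W.X) a).hom) fun x ↦ by
        simpa only [LinearMap.comp_apply, LinearMap.id_apply] using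
          LinearMap.congr_fun (map_sliceAt_comp_map_fst (X := X) w₀ a) x
  · -- `n < e`: `b = a + 2m`; `ι := pr_X^* : Hᵇ(X) ↪ Hᵇ(Z)`, `p := pr_{X*} : Hᵇ(Z) ↠ Hᵃ(X)`
    obtain ⟨W, hWd⟩ := exists_abelianVariety_dim_eq_succ ℂ (e - n - 1)
    have hm : n + W.dim = e := by omega
    have hW : IsSmoothProjective W.dim W.X := AbelianVariety.isSmoothProjective_holds (A := W)
    have hZ : IsSmoothProjective (n + W.dim) (X ⊗ W.X) := hX.tensor_holds hW
    set w₀ : ComplexPoints W.X := (1 : W.Points ℂ)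
    have h1 : a + 2 * (n + W.dim) = b + 2 * n := by omega
    have h2 : b + 2 * n = a + 2 * (n + W.dim) := by omega
    obtain ⟨eι, hιd, hι⟩ := mem_map_corrAction_motivatedClasses_of_isAlgebraicCorrespondence hZ hX
      (isAlgebraicCorrespondence_map hZ hX (fst X W.X) (a := b) (by omega))
    obtain ⟨ep, hpd, hp⟩ := mem_map_corrAction_motivatedClasses_of_isAlgebraicCorrespondence hX hZ
      (isAlgebraicCorrespondence_complexGysin complexOrientationFamily hPD hZ hX (fst X W.X) h2
        (show a + (2 * n - a) = 2 * n by omega))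
    refine exists_motivated_quasiInverse_of_injective_of_surjective hX hZ hb (k := b) (by omega) hιd hpd hab hι hp
      ?_ ?_ hu
    · exact Function.LeftInverse.injective (g := (complexBetti.map (sliceAt X w₀) b).hom) fun x ↦ by
        simpa only [LinearMap.comp_apply, LinearMap.id_apply] using
          LinearMap.congr_fun (map_sliceAt_comp_map_fst (X := X) w₀ b) x
    · exact Function.RightInverse.surjective
        (g := complexGysin complexOrientationFamily hX hZ (sliceAt X w₀) h1) fun x ↦ by
          simpa only [LinearMap.comp_apply, LinearMap.id_apply] using
            LinearMap.congr_fun (complexGysin_fst_comp_complexGysin_sliceAt hX hW w₀ h1 h2) x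

/-- **Every ALGEBRAIC correspondence `u : Hᵃ(X(ℂ); ℂ) → Hᵇ(X(ℂ); ℂ)` (`a, b ≤ 2 dim X`) has a MOTIVATED quasi-inverse —
no `B(X)`** (algebraic ⟹ motivated, then `exists_motivated_quasiInverse`). This is the unconditional shadow of the supply
node (Q): under `B` the motivated quasi-inverse would be algebraic. [cite: Andre1996Motifs, Thm. 0.4 (p. 7) and §2.1 (p. 14)] -/
theorem exists_motivated_quasiInverse_of_isAlgebraicCorrespondence (hX : IsSmoothProjective n X) {a b : ℕ}
    (ha : a ≤ 2 * n) (hb : b ≤ 2 * n) {u : complexBetti X a →ₗ[ℂ] complexBetti X b}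
    (hu : IsAlgebraicCorrespondence n n X X u) :
    ∃ (e' : ℕ) (hba : b + 2 * e' = a + 2 * n) (v : complexBetti X b →ₗ[ℂ] complexBetti X a),
      v ∈ (motivatedClasses (n + n) (X ⊗ X) e').map (corrAction complexOrientationFamily hX hX hba) ∧
        ∀ x : complexBetti X a, u (v (u x)) = u x := by
  obtain ⟨e, hab, hu'⟩ := mem_map_corrAction_motivatedClasses_of_isAlgebraicCorrespondence hX hX hu
  exact exists_motivated_quasiInverse hX ha hb hab hu'

end Unconditional

/-! ## §3 Node (Q) at `X` from «motivated ⟹ algebraic» on the square, one codimension — no `B` -/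

section Square

variable {n : ℕ} {X : SchemeOver ℂ}

/-- **(Q)'s conclusion at `X` WITHOUT `B(X)`, from «A_mot = A» on `X ⊗ X` in the single codimension `e'` of the
quasi-inverse** (`a + 2e = b + 2n`, `e + e' = 2n`): if the motivated classes of codimension `e'` on `X ⊗ X` are
algebraic, every algebraic `u : Hᵃ(X) → Hᵇ(X)` has an ALGEBRAIC quasi-inverse. (Row b05's parent
`MotivatedImpliesAlgebraic`, localised to one square and one codimension; compare `HC^{e'}(X ⊗ X) ⟹` the same, the
sub-cell's `…QuasiInverseHodge.exists_algebraic_quasiInverse_of_hodgeConjectureFor_sq`, STRONGER hypothesis since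
motivated classes are Hodge classes.) [cite: Andre1996Motifs, Thm. 0.4 (p. 7) and §2.1 (p. 14)] -/
theorem exists_algebraic_quasiInverse_of_motivatedClasses_sq_le (hX : IsSmoothProjective n X) {a b e e' : ℕ}
    (ha : a ≤ 2 * n) (hb : b ≤ 2 * n) (hab : a + 2 * e = b + 2 * n) (hee' : e + e' = 2 * n)
    (hsq : motivatedClasses (n + n) (X ⊗ X) e' ≤ algebraicClasses (X ⊗ X) e')
    {u : complexBetti X a →ₗ[ℂ] complexBetti X b} (hu : IsAlgebraicCorrespondence n n X X u) :
    ∃ v : complexBetti X b →ₗ[ℂ] complexBetti X a,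
      IsAlgebraicCorrespondence n n X X v ∧ ∀ x : complexBetti X a, u (v (u x)) = u x := by
  obtain ⟨e₁, hba, v, ⟨γ, hγ, hv⟩, hvu⟩ := exists_motivated_quasiInverse_of_isAlgebraicCorrespondence hX ha hb hu
  obtain rfl : e' = e₁ := by omega
  refine ⟨v, ?_, hvu⟩
  rw [← hv]
  exact isAlgebraicCorrespondence_corrAction_complex hX hX hba ha (hsq hγ)

end Square

end Summit.HodgeConjecture.HodgeConjecture.Theorems

end
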